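/-
Copyright (c) 2026. All rights reserved.
Released under Apache 2.0 license as described in the file LICENSE.
Authors: abc-iut cell, discharge seat abc-iut-w4-d095 (wave 4, gen 3).
-/
import Literature.AnabelianGeometry.AbsoluteAnabelian.LogFrobeniusLogWallIndependence
import Literature.AnabelianGeometry.AbsoluteAnabelian.LogFrobeniusCoresProofs
import Literature.AnabelianGeometry.AbsoluteAnabelian.LogFrobeniusRigidity
import Literature.AnabelianGeometry.AbsoluteAnabelian.FundamentalExtension
import HarnessLib

/-!
# [AbsTopIII] Corollary 5.5 (i)+(iii) "compatible with one another": `RealisesCor55Families` (FACT-LIST F-0159) at the DIAGONAL setting — kernel calibration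

S. Mochizuki, *Topics in absolute anabelian geometry III: global reconstruction algorithms*,
J. Math. Sci. Univ. Tokyo 22 (2015) 939–1156 [MochizukiAbsTopIII2015]; locators `p.N` = pages of the
author's manuscript (`paper:url-5493eb38cbb7`): Def 3.5 (ii), (iii) pp. 75–76, Cor 5.5 (i), (iii) pp. 130–131 ("these
families of homotopies are compatible with one another as well as with the families of homotopies that constitute
the core and telecore structures of (i), (ii)").

PROOF-ONLY companion of `LogFrobeniusRigidity.lean` (abc-iut-L4-t3 / abc-iut-w5-d112: the `Prop`
`LogFrobeniusSetting.RealisesCor55Families K` — ONE family `K` on `D•⊢` into which core structures of `D•_{≤5}`,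
`D•_{≤6}`, `D•_{≤7}` on `D•_{≤4}`, `D•_{≤5}`, `D•_{≤6}` and the observables `S_log⊞_v` all embed; FACT-LIST F-0159,
fact-open) and of this seat's `LogFrobeniusLogWallIndependence.lean` (p427401: the diagonal setting
`LogFrobeniusSetting.diagonal`, its strict-commutation families, `diagonal_isLogObservablePlus`,
`diagonalObsFamily_compatibleIn`).  Kernel facts:

* `LogFrobeniusSetting.diagonal_realisesCor55Families` — for `V(F_mod) ≠ ∅` the strict-commutation family of ALL
  co-verticial pairs of `D•⊢` at the diagonal setting REALISES the Cor 5.5 families: the strict commutations of the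
  pairs ending at `ℰ•` (row 5), `An•[𝒳]` (row 6), `ℰ•` (row 7), `𝒩⊞_v` are cores / observables (reachability of the core
  vertices = abc-iut-L4-t10's `reach_e5` / `reach_an` / `reach_e7`) and embed into it.  Hence
  `exists_realisesCor55Families`: F-0159 is SATISFIABLE over every nonempty index set (DEGENERATE calibration witness,
  honest label: no arithmetic content).
* `LogFrobeniusSetting.not_exists_realisesCor55Families_of_isEmpty` — for an EMPTY index set NO setting whatsoever
  admits such a family (the vertex `□` cannot reach `ℰ•`; same mechanism as `not_cor55Cores_of_isEmpty`), so the
  universal closure of F-0159 over all `(Vmod, isArc, L, K)` is refutable in the degenerate corner `V(F_mod) = ∅` — which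
  a number field never presents — exactly like F-0140 `Cor55Cores` (`cor55Cores_iff_nonempty`).

Refereed pre-IUT anabelian geometry; nothing here bears on [IUTchIII] Cor. 3.12; calibration of typed statements only;
typed ≠ proved.
-/

universe u

open CategoryTheory Quiver

namespace Literature.AnabelianGeometry.AbsoluteAnabelian

namespace LogFrobeniusSetting

variable (Vmod : Type u) (isArc : Vmod → Bool) (C : Type (u + 1)) [Category.{u} C]

/-- At the diagonal setting, the strict commutations of the pairs ending at `x` form a core of `D•_{≤P} ∪ {x}` on `D•_{≤P}`
EMBEDDED in the strict-commutation family of `D•⊢`, as soon as every vertex of `D•_{≤P}` reaches `x`.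
[cite: MochizukiAbsTopIII2015, Cor 5.5 (i) p. 130] -/
theorem diagonal_isCoreOnIn (P : DVertex Vmod isArc → Prop) (x : DVertex Vmod isArc)
    (hreach : ∀ a : DSub P, Nonempty (Path ((obsShape P x).base a) (obsShape P x).obs)) :
    (diagonal Vmod isArc C).IsCoreOnIn (diagonalFamily Vmod isArc C) P x :=
  ⟨diagonalObsFamily Vmod isArc C P x, diagonalObsFamily_terminal Vmod isArc C P x,
    ⟨fun _ _ _ => rfl, hreach⟩, diagonalObsFamily_compatibleIn Vmod isArc C P x⟩

/-- **F-0159 at the diagonal setting**: for `V(F_mod) ≠ ∅` the strict-commutation family of all co-verticial pairs of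
`D•⊢` realises the cores of Cor 5.5 (i) (`ℰ•`, `An•[𝒳]`, `ℰ•` of rows 5, 6, 7) and the observables `S_log⊞_v` of Cor
5.5 (iii), all EMBEDDED in it ("compatible with one another").  DEGENERATE calibration witness.
[cite: MochizukiAbsTopIII2015, Cor 5.5 (iii) p. 131] -/
theorem diagonal_realisesCor55Families [Nonempty Vmod] :
    (diagonal Vmod isArc C).RealisesCor55Families (diagonalFamily Vmod isArc C) :=
  ⟨diagonal_isCoreOnIn Vmod isArc C _ _ reach_e5, diagonal_isCoreOnIn Vmod isArc C _ _ reach_an,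
    diagonal_isCoreOnIn Vmod isArc C _ _ reach_e7,
    fun v => ⟨diagonalObsFamily Vmod isArc C (DVertex.InFirstRows 2) (.nplus v),
      diagonal_isLogObservablePlus Vmod isArc C v,
      diagonalObsFamily_compatibleIn Vmod isArc C (DVertex.InFirstRows 2) (.nplus v)⟩⟩

/-- **`RealisesCor55Families` (F-0159) is satisfiable over every NONEMPTY index set**, at a setting with `𝒳 = C` for any
large category `C`. [cite: MochizukiAbsTopIII2015, Cor 5.5 (iii) p. 131] -/
theorem exists_realisesCor55Families [Nonempty Vmod] :
    ∃ L : LogFrobeniusSetting Vmod isArc, L.X = C ∧ ∃ K : L.diagram.HomotopyFamily, L.RealisesCor55Families K :=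
  ⟨diagonal Vmod isArc C, rfl, diagonalFamily Vmod isArc C, diagonal_realisesCor55Families Vmod isArc C⟩

variable {Vmod isArc}

/-- **For an EMPTY index set no setting admits a family realising the Cor 5.5 families** (the vertex `□` of `D•_{≤4}`
cannot reach the would-be core vertex `ℰ•`: Def 3.5 (iii) fails) — the universal closure of F-0159 is refutable in the
degenerate corner `V(F_mod) = ∅`, which a number field never presents (cf. `not_cor55Cores_of_isEmpty`).
[cite: MochizukiAbsTopIII2015, Cor 5.5 (i) p. 130] -/
theorem not_exists_realisesCor55Families_of_isEmpty [IsEmpty Vmod] (L : LogFrobeniusSetting Vmod isArc) :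
    ¬ ∃ K : L.diagram.HomotopyFamily, L.RealisesCor55Families K := by
  rintro ⟨K, ⟨H, hH, hcore, -⟩, -, -, -⟩
  have hc : DVertex.InFirstRows (Vmod := Vmod) (isArc := isArc) 4 .core := ⟨trivial, by simp [DVertex.row]⟩
  obtain ⟨p⟩ := hcore.reaches_obs ⟨.core, hc⟩
  have h := eq_core_of_path_of_isEmpty (P := DVertex.InFirstRows 4) hc (x := .e5) (fun i => by cases i) p
  change ExtVertex.obs = ExtVertex.base _ at h
  cases h

variable (Vmod isArc)

/-- **F-0159 calibrated**: some setting over `(Vmod, isArc)` admits a family realising the Cor 5.5 families if and only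
if `Vmod` is nonempty (witness: the diagonal setting on `FundamentalExtension.{u}`).
[cite: MochizukiAbsTopIII2015, Cor 5.5 (iii) p. 131] -/
theorem exists_realisesCor55Families_iff_nonempty :
    (∃ (L : LogFrobeniusSetting Vmod isArc) (K : L.diagram.HomotopyFamily), L.RealisesCor55Families K) ↔
      Nonempty Vmod := by
  refine ⟨fun ⟨L, K, hK⟩ => ?_, fun _ => ?_⟩
  · by_contra hV
    rw [not_nonempty_iff] at hV
    exact not_exists_realisesCor55Families_of_isEmpty L ⟨K, hK⟩
  · exact ⟨diagonal Vmod isArc FundamentalExtension.{u}, diagonalFamily Vmod isArc FundamentalExtension.{u},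
      diagonal_realisesCor55Families Vmod isArc FundamentalExtension.{u}⟩

end LogFrobeniusSetting

end Literature.AnabelianGeometry.AbsoluteAnabelian
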